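import Mathlib
import Summits.Ventures.HodgeRepro2.T5AdicCompletionUnitIndex
import Summits.Ventures.HodgeRepro2.T5CharacterCount
import Summits.Ventures.HodgeRepro2.T5RamifiedUnitIndex
import Summits.Ventures.HodgeRepro2.T5AdicCompletionRamified

/-!
# The COUNTS at a RAMIFIED place: `2q^k` conjugate-orthogonal characters of conductor `≤ 2k`,
  `2(q−1)q^{k-1}` of conductor exactly `2k`, none of odd conductor

The ramified counterpart of `T5InertCharacterCount`: on the concrete pair `Kv ⊆ Lw` at a RAMIFIED
quadratic place (`[Lw : Kv] = 2`, `ϖ` a uniformiser of `Kv` that is NOT a uniformiser of `Lw`, so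
`ϖ = u·π²` and `e = 2`, `f = 1`, both residue fields of order `q`), with `N n := F_v^× ⊔ U_E^n`:

* `val_algebraMap_eq_exp_neg_two`: `w(ϖ) = exp (-2)` (the ramification index is `2`);
* `index_range_sup_map_higherUnits_two_mul_of_ramified`: `[Lwˣ : N (2k)] = 2·q^k` (`k ≥ 1`);
* `index_range_sup_map_higherUnits_two_mul_add_one_of_ramified`: `[Lwˣ : N (2k+1)] = 2·q^k`;
* `index_range_sup_map_higherUnits_one_of_ramified`, `…_zero_of_ramified`: `[Lwˣ : N 1] = [Lwˣ : N 0] = 2`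
  (the two unramified characters trivial on `F_v^×`: `1` and the unramified quadratic one);
* `ncard_conjugateOrthogonal_two_mul`: `#{χ ∣ χ|_{N (2k)} = 1} = 2·q^k`;
* `ncard_conjugateOrthogonal_exact_two_mul`: exactly `2q^k − 2q^{k-1}` of conductor exactly `2k`;
* `ncard_conjugateOrthogonal_exact_two_mul_add_one`: NONE of odd conductor `2k+1`
  (Lemma N5.L4(iv-b) and its parenthesis, quantitatively).

Declaration per README §8(d): «uses an L-value-free non-vanishing device: NO».
-/

namespace Summit.Ventures.HodgeRepro2.T5RamifiedCharacterCount

open IsDedekindDomain HeightOneSpectrum T5PrincipalUnitFiltration T5PrincipalUnitComparison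
  T5AdicCompletionUnitIndex T5CharacterCount

variable {K : Type*} [Field K] [NumberField K] (v : HeightOneSpectrum (NumberField.RingOfIntegers K))
variable {L : Type*} [Field L] [NumberField L] [Algebra K L]
  (w : HeightOneSpectrum (NumberField.RingOfIntegers L))
variable [Algebra (adicCompletion K v) (adicCompletion L w)]
  [ContinuousSMul (adicCompletion K v) (adicCompletion L w)]
  [IsScalarTower K (adicCompletion K v) (adicCompletion L w)]

omit [Algebra K L] [ContinuousSMul (adicCompletion K v) (adicCompletion L w)]
  [IsScalarTower K (adicCompletion K v) (adicCompletion L w)] in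
/-- `N n ≤ N m` for `m ≤ n`. -/
theorem range_sup_map_higherUnits_antitone (π : adicCompletionIntegers L w) {m n : ℕ} (hmn : m ≤ n) :
    (T5UnramifiedCharacter.baseUnits v w).range ⊔ (higherUnits π n).map
        (Units.map (algebraMap (adicCompletionIntegers L w) (adicCompletion L w) :
          adicCompletionIntegers L w →* adicCompletion L w)) ≤
    (T5UnramifiedCharacter.baseUnits v w).range ⊔ (higherUnits π m).map
        (Units.map (algebraMap (adicCompletionIntegers L w) (adicCompletion L w) :
          adicCompletionIntegers L w →* adicCompletion L w)) :=
  sup_le_sup_left (Subgroup.map_mono (higherUnits_antitone _ hmn)) _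

section Ramified

variable (hfin : Module.finrank (adicCompletion K v) (adicCompletion L w) = 2)
  {ϖ : adicCompletionIntegers K v} (hϖ : Irreducible ϖ) {π : adicCompletionIntegers L w}
  (hπ : Irreducible π)
  (hram : ¬ Irreducible (algebraMap (adicCompletionIntegers K v) (adicCompletionIntegers L w) ϖ))

include hfin hϖ hπ hram

/-- The ramification index is `2`: `w(ϖ) = exp (-2)`. -/
theorem val_algebraMap_eq_exp_neg_two :
    Valued.v (algebraMap (adicCompletion K v) (adicCompletion L w) (ϖ : adicCompletion K v)) =
      WithZero.exp (-((2 : ℕ) : ℤ)) := by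
  obtain ⟨u, hu⟩ := T5AdicCompletionRamified.exists_unit_algebraMap_eq_mul_sq v w hfin hϖ hπ hram
  have h2 : algebraMap (adicCompletion K v) (adicCompletion L w)
      (algebraMap (adicCompletionIntegers K v) (adicCompletion K v) ϖ) =
      algebraMap (adicCompletionIntegers L w) (adicCompletion L w)
        (algebraMap (adicCompletionIntegers K v) (adicCompletionIntegers L w) ϖ) := by
    rw [← IsScalarTower.algebraMap_apply, ← IsScalarTower.algebraMap_apply]
  have hπv : Valued.v (π : adicCompletion L w) = WithZero.exp (-1) :=
    (T5AdicCompletionConductor.irreducible_iff_val_eq_exp_neg_one w π).mp hπ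
  have huv : Valued.v (algebraMap (adicCompletionIntegers L w) (adicCompletion L w) (u : adicCompletionIntegers L w)) = 1 := by
    have hmem : Units.map (algebraMap (adicCompletionIntegers L w) (adicCompletion L w) :
        adicCompletionIntegers L w →* adicCompletion L w) u ∈
        (Valued.v (R := adicCompletion L w)).valuationSubring.unitGroup := by
      rw [← range_unitsMap_integers w]
      exact ⟨u, rfl⟩
    rw [Valuation.mem_unitGroup_iff, Units.coe_map] at hmem
    exact hmem
  change Valued.v (algebraMap (adicCompletion K v) (adicCompletion L w)
    (algebraMap (adicCompletionIntegers K v) (adicCompletion K v) ϖ)) = _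
  rw [h2, hu, map_mul, map_pow, Valuation.map_mul, Valuation.map_pow, huv, one_mul]
  change Valued.v (π : adicCompletion L w) ^ 2 = _
  rw [hπv, ← WithZero.exp_nsmul]
  norm_num

/-- `[Lwˣ : F_v^× ⊔ U_E^n] = 2·[(O_{Lw})ˣ : (O_{Kv})ˣ ⊔ U_E^n]` at a ramified place (any `n`). -/
theorem index_range_sup_map_higherUnits_of_ramified (n : ℕ) :
    ((T5UnramifiedCharacter.baseUnits v w).range ⊔ (higherUnits π n).map
      (Units.map (algebraMap (adicCompletionIntegers L w) (adicCompletion L w) :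
        adicCompletionIntegers L w →* adicCompletion L w))).index =
      2 * ((unitsMap (R := adicCompletionIntegers K v) (S := adicCompletionIntegers L w)).range ⊔
        higherUnits π n).index :=
  index_range_baseUnits_sup_map_higherUnits v w
    ((T5AdicCompletionConductor.irreducible_iff_val_eq_exp_neg_one v ϖ).mp hϖ) two_pos
    (val_algebraMap_eq_exp_neg_two v w hfin hϖ hπ hram) π n

variable {q : ℕ} (hq : 2 ≤ q)
  (hk : Nat.card (IsLocalRing.ResidueField (adicCompletionIntegers K v)) = q)
  (hku : Nat.card (IsLocalRing.ResidueField (adicCompletionIntegers K v))ˣ = q - 1)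
  (hK : Nat.card (IsLocalRing.ResidueField (adicCompletionIntegers L w)) = q)
  (hKu : Nat.card (IsLocalRing.ResidueField (adicCompletionIntegers L w))ˣ = q - 1)

include hq hk hku hK hKu

/-- `[Lwˣ : F_v^× U_E^{2k}] = 2·q^k` (`k ≥ 1`). -/
theorem index_range_sup_map_higherUnits_two_mul_of_ramified {k : ℕ} (hk1 : 1 ≤ k) :
    ((T5UnramifiedCharacter.baseUnits v w).range ⊔ (higherUnits π (2 * k)).map
      (Units.map (algebraMap (adicCompletionIntegers L w) (adicCompletion L w) :
        adicCompletionIntegers L w →* adicCompletion L w))).index = 2 * q ^ k := by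
  obtain ⟨u, hu⟩ := T5AdicCompletionRamified.exists_unit_algebraMap_eq_mul_sq v w hfin hϖ hπ hram
  rw [index_range_sup_map_higherUnits_of_ramified v w hfin hϖ hπ hram,
    T5RamifiedUnitIndex.index_sup_two_mul_eq_of_card hϖ hπ hu hq hk hku hK hKu hk1]

/-- `[Lwˣ : F_v^× U_E^{2k+1}] = 2·q^k` (`k ≥ 1`): the odd levels add nothing. -/
theorem index_range_sup_map_higherUnits_two_mul_add_one_of_ramified {k : ℕ} (hk1 : 1 ≤ k) :
    ((T5UnramifiedCharacter.baseUnits v w).range ⊔ (higherUnits π (2 * k + 1)).map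
      (Units.map (algebraMap (adicCompletionIntegers L w) (adicCompletion L w) :
        adicCompletionIntegers L w →* adicCompletion L w))).index = 2 * q ^ k := by
  obtain ⟨u, hu⟩ := T5AdicCompletionRamified.exists_unit_algebraMap_eq_mul_sq v w hfin hϖ hπ hram
  rw [index_range_sup_map_higherUnits_of_ramified v w hfin hϖ hπ hram,
    T5RamifiedUnitIndex.index_sup_two_mul_add_one_eq_of_card hϖ hπ hu hq hk hku hK hKu
      (T5AdicCompletionRamified.exists_dvd_sub_algebraMap_of_not_irreducible v w hfin hϖ hπ hram) hk1]

omit hq hk hku hK hKu in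
/-- `[Lwˣ : F_v^× U_E] = 2`: exactly two unramified characters are trivial on `F_v^×`. -/
theorem index_range_sup_map_higherUnits_zero_of_ramified :
    ((T5UnramifiedCharacter.baseUnits v w).range ⊔ (higherUnits π 0).map
      (Units.map (algebraMap (adicCompletionIntegers L w) (adicCompletion L w) :
        adicCompletionIntegers L w →* adicCompletion L w))).index = 2 := by
  rw [index_range_sup_map_higherUnits_of_ramified v w hfin hϖ hπ hram, higherUnits_zero, sup_top_eq,
    Subgroup.index_top, mul_one]

omit hq hk hku hK hKu in
/-- `[Lwˣ : F_v^× U_E^1] = 2` as well (`f = 1`: the units of `O_{Kv}` fill the residue field). -/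
theorem index_range_sup_map_higherUnits_one_of_ramified :
    ((T5UnramifiedCharacter.baseUnits v w).range ⊔ (higherUnits π 1).map
      (Units.map (algebraMap (adicCompletionIntegers L w) (adicCompletion L w) :
        adicCompletionIntegers L w →* adicCompletion L w))).index = 2 := by
  obtain ⟨u, hu⟩ := T5AdicCompletionRamified.exists_unit_algebraMap_eq_mul_sq v w hfin hϖ hπ hram
  rw [index_range_sup_map_higherUnits_of_ramified v w hfin hϖ hπ hram, sup_comm,
    show (1 : ℕ) = 2 * 0 + 1 from rfl,
    ← T5RamifiedUnitFiltration.higherUnits_two_mul_sup_eq hϖ hπ hu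
      (T5AdicCompletionRamified.exists_dvd_sub_algebraMap_of_not_irreducible v w hfin hϖ hπ hram) 0,
    mul_zero, higherUnits_zero, top_sup_eq, Subgroup.index_top, mul_one]

/-- CONDUCTOR `≤ 2k`: `2·q^k` characters trivial on `F_v^×` and on `U_E^{2k}`. -/
theorem ncard_conjugateOrthogonal_two_mul {k : ℕ} (hk1 : 1 ≤ k) :
    {χ : (adicCompletion L w)ˣ →* ℂˣ | ∀ y ∈ (T5UnramifiedCharacter.baseUnits v w).range ⊔
      (higherUnits π (2 * k)).map
        (Units.map (algebraMap (adicCompletionIntegers L w) (adicCompletion L w) :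
          adicCompletionIntegers L w →* adicCompletion L w)), χ y = 1}.ncard = 2 * q ^ k := by
  have h := index_range_sup_map_higherUnits_two_mul_of_ramified v w hfin hϖ hπ hram hq hk hku hK hKu
    hk1
  rw [ncard_setOf_eq_one_on _ (by rw [h]; positivity), h]

/-- CONDUCTOR EXACTLY `2k` (`k ≥ 2`): `2q^k − 2q^{k-1}` characters. -/
theorem ncard_conjugateOrthogonal_exact_two_mul {k : ℕ} (hk2 : 2 ≤ k) :
    {χ : (adicCompletion L w)ˣ →* ℂˣ | (∀ y ∈ (T5UnramifiedCharacter.baseUnits v w).range ⊔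
      (higherUnits π (2 * k)).map
        (Units.map (algebraMap (adicCompletionIntegers L w) (adicCompletion L w) :
          adicCompletionIntegers L w →* adicCompletion L w)), χ y = 1) ∧
      ¬ ∀ y ∈ (T5UnramifiedCharacter.baseUnits v w).range ⊔
      (higherUnits π (2 * k - 1)).map
        (Units.map (algebraMap (adicCompletionIntegers L w) (adicCompletion L w) :
          adicCompletionIntegers L w →* adicCompletion L w)), χ y = 1}.ncard =
      2 * q ^ k - 2 * q ^ (k - 1) := by
  have h1 := index_range_sup_map_higherUnits_two_mul_of_ramified v w hfin hϖ hπ hram hq hk hku hK hKu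
    (k := k) (by omega)
  have h2 := index_range_sup_map_higherUnits_two_mul_add_one_of_ramified v w hfin hϖ hπ hram hq hk
    hku hK hKu (k := k - 1) (by omega)
  rw [show 2 * k - 1 = 2 * (k - 1) + 1 by omega,
    ncard_setOf_eq_one_on_and_not (range_sup_map_higherUnits_antitone v w π (by omega))
      (by rw [h1]; positivity), h1, h2]

/-- CONDUCTOR EXACTLY `2` : `2(q−1)` characters (`N 1 = N 0` has index `2`). -/
theorem ncard_conjugateOrthogonal_exact_two :
    {χ : (adicCompletion L w)ˣ →* ℂˣ | (∀ y ∈ (T5UnramifiedCharacter.baseUnits v w).range ⊔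
      (higherUnits π 2).map
        (Units.map (algebraMap (adicCompletionIntegers L w) (adicCompletion L w) :
          adicCompletionIntegers L w →* adicCompletion L w)), χ y = 1) ∧
      ¬ ∀ y ∈ (T5UnramifiedCharacter.baseUnits v w).range ⊔
      (higherUnits π 1).map
        (Units.map (algebraMap (adicCompletionIntegers L w) (adicCompletion L w) :
          adicCompletionIntegers L w →* adicCompletion L w)), χ y = 1}.ncard = 2 * (q - 1) := by
  have h1 := index_range_sup_map_higherUnits_two_mul_of_ramified v w hfin hϖ hπ hram hq hk hku hK hKu
    (k := 1) le_rfl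
  have h2 := index_range_sup_map_higherUnits_one_of_ramified v w hfin hϖ hπ hram
  rw [mul_one, pow_one] at h1
  rw [ncard_setOf_eq_one_on_and_not (range_sup_map_higherUnits_antitone v w π one_le_two)
      (by rw [h1]; positivity), h1, h2, Nat.mul_sub_one]

/-- NO conjugate-orthogonal character of odd conductor `2k+1` (`k ≥ 1`). -/
theorem ncard_conjugateOrthogonal_exact_two_mul_add_one {k : ℕ} (hk1 : 1 ≤ k) :
    {χ : (adicCompletion L w)ˣ →* ℂˣ | (∀ y ∈ (T5UnramifiedCharacter.baseUnits v w).range ⊔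
      (higherUnits π (2 * k + 1)).map
        (Units.map (algebraMap (adicCompletionIntegers L w) (adicCompletion L w) :
          adicCompletionIntegers L w →* adicCompletion L w)), χ y = 1) ∧
      ¬ ∀ y ∈ (T5UnramifiedCharacter.baseUnits v w).range ⊔
      (higherUnits π (2 * k)).map
        (Units.map (algebraMap (adicCompletionIntegers L w) (adicCompletion L w) :
          adicCompletionIntegers L w →* adicCompletion L w)), χ y = 1}.ncard = 0 := by
  have h1 := index_range_sup_map_higherUnits_two_mul_add_one_of_ramified v w hfin hϖ hπ hram hq hk
    hku hK hKu hk1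
  have h2 := index_range_sup_map_higherUnits_two_mul_of_ramified v w hfin hϖ hπ hram hq hk hku hK hKu
    hk1
  rw [ncard_setOf_eq_one_on_and_not (range_sup_map_higherUnits_antitone v w π (by omega))
    (by rw [h1]; positivity), h1, h2, Nat.sub_self]

end Ramified

end Summit.Ventures.HodgeRepro2.T5RamifiedCharacterCount
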